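import Summits.Parity.GeneralizedHardyLittlewood.Theorems.PrimeLevelFamEdgeMomentsBeyondDiagonalDiagBoseZero
import Summits.Parity.GeneralizedHardyLittlewood.Theorems.BeyondDiagonalBeatsQuarter.PeterssonSplit
import Literature.NumberTheory.LFunctions.KMVFirstMomentBeyondDiagonal
import HarnessLib

/-!
# Route `PrimeLevelFamEdge`, crux K_A `MomentsBeyondDiagonal` (stmt-Parity-20007), line «petersson_layers» v4, stub `stub_diag`:
# AT `Q = 1` THE EXPLICIT LINE SERIES IS EXACTLY `2q̂ · Σ x_{m₁}x_{m₂}(m₁m₂)^{1/2} K_true(q̂; m₁, m₂)` (K_B's kernel form, every `P`)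

`…DiagShapeOfSeries` (p812418) reduces `stub_diag` to the asymptotics of the explicit order-`(i,j)` line series. At `Q = 1` (only
`(i,j) = (0,0)`) that series is, pair by pair and EXACTLY, K_B's true diagonal kernel form: by `…DiagBoseZero` the Bose double integral
at order `(0,0)` is `𝒲(K/q̂²)` (`Corner.scriptW`), `K = (m₁/c)(m₂/c)` depends on the Hecke divisors only through `c = gcd(m₁/d₁, m₂/d₂)`,
and K_B's fibre count `PeterssonSplit.sum_divisorPairs_gcd` collapses `Σ_{d₁∣m₁,d₂∣m₂}` onto `Σ_{c∣(m₁,m₂)} τ((m₁/c)(m₂/c))`: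

* `lineSeries_pair_zero_zero` — `Σ_{d₁∣a,d₂∣b} c (ab)^{−1/2} 𝔚₀₀(·,·;K/q̂²) = (ab)^{1/2} · Corner.trueDiagKernel q̂ a b`;
* `lineSeries_one_eq` — **the explicit line series at `Q = 1` equals `2q̂ Σ_{m₁,m₂≤M} x_{m₁}x_{m₂}(m₁m₂)^{1/2}K_true(q̂;m₁,m₂)`** (every `P`, `Δ'`).

So «`SubDiag` at `(P, 1)`» for all admissible `P` (census R3(i)) is PRECISELY the asymptotic evaluation of K_B's kernel form
`Σ_{a,b≤M} x_a x_b K_true(q̂;a,b)` for a general profile `P` — K_B's `KernelFormXSq*` + `Corner*` did `P = X²`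
(`KernelFormXSq.kernelForm_xsq_asymp`, `Corner.abs_corner_le`; used in `…DiagXSqOne`). Helper `--supports stmt-Parity-20007`; closes
nothing; K_A, K_B and the Parity summit are NOT proved; nothing about Landau–Siegel zeros.
-/

noncomputable section

open scoped Real
open Complex Finset MeasureTheory Polynomial
open Literature.NumberTheory.LFunctions

namespace Summit.Parity.GeneralizedHardyLittlewood.Theorems.MomentsBeyondDiagonal.DiagLines

open Summit.Parity.GeneralizedHardyLittlewood.Theorems.BeyondDiagonalBeatsQuarter
open Summit.Parity.GeneralizedHardyLittlewood.Theorems.BeyondDiagonalBeatsQuarter.PeterssonSplit (sum_divisorPairs_gcd)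

/-- **The order-`(0,0)` line series of one pair is K_B's true diagonal kernel**: for `Q > 0`, `a, b ≠ 0`,
`Σ_{d₁∣a} Σ_{d₂∣b} gcd(a/d₁,b/d₂) · (ab)^{−1/2} · ∫_{u₁>0} ∫_{u₂>K/Q²/u₁} e^{−φ}(1−e^{−φ})^{−2} = (ab)^{1/2} · Corner.trueDiagKernel Q a b`,
`K = (a/c)(b/c)`. [cite: KowalskiMichelVanderKam2000, (21)–(23) p. 12–13 — derivation] -/
theorem lineSeries_pair_zero_zero {Q : ℝ} (hQ : 0 < Q) {a b : ℕ} (ha : a ≠ 0) (hb : b ≠ 0) :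
    ∑ d₁ ∈ a.divisors, ∑ d₂ ∈ b.divisors,
      (((a / d₁).gcd (b / d₂) : ℝ) * ((a : ℝ) * b) ^ (-(1 / 2 : ℝ)) *
        ∫ u₁ in Set.Ioi (0 : ℝ),
          ∫ u₂ in Set.Ioi (((((a / (a / d₁).gcd (b / d₂)) * (b / (a / d₁).gcd (b / d₂)) : ℕ) : ℝ) / Q ^ 2) / u₁),
            Real.exp (-(u₁ + u₂)) / (1 - Real.exp (-(u₁ + u₂))) ^ 2) =
      ((a : ℝ) * b) ^ (1 / 2 : ℝ) * Corner.trueDiagKernel Q a b := by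
  have hab : (0 : ℝ) < (a : ℝ) * b := by
    have : (0 : ℝ) < a := by exact_mod_cast Nat.pos_of_ne_zero ha
    have : (0 : ℝ) < b := by exact_mod_cast Nat.pos_of_ne_zero hb
    positivity
  -- each summand depends on `(d₁, d₂)` only through `c = gcd(a/d₁, b/d₂)`
  set G : ℕ → ℝ := fun c ↦ (c : ℝ) * ((a : ℝ) * b) ^ (-(1 / 2 : ℝ)) *
    Corner.scriptW ((((a / c) * (b / c) : ℕ) : ℝ) / Q ^ 2) with hG
  have hterm : ∀ d₁ ∈ a.divisors, ∀ d₂ ∈ b.divisors,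
      (((a / d₁).gcd (b / d₂) : ℝ) * ((a : ℝ) * b) ^ (-(1 / 2 : ℝ)) *
        ∫ u₁ in Set.Ioi (0 : ℝ),
          ∫ u₂ in Set.Ioi (((((a / (a / d₁).gcd (b / d₂)) * (b / (a / d₁).gcd (b / d₂)) : ℕ) : ℝ) / Q ^ 2) / u₁),
            Real.exp (-(u₁ + u₂)) / (1 - Real.exp (-(u₁ + u₂))) ^ 2) = G ((a / d₁).gcd (b / d₂)) := by
    intro d₁ hd₁ d₂ hd₂
    have hd₁' := (Nat.mem_divisors.mp hd₁).1
    have hd₂' := (Nat.mem_divisors.mp hd₂).1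
    have hca : (a / d₁).gcd (b / d₂) ∣ a := (Nat.gcd_dvd_left _ _).trans (Nat.div_dvd_of_dvd hd₁')
    have hcb : (a / d₁).gcd (b / d₂) ∣ b := (Nat.gcd_dvd_right _ _).trans (Nat.div_dvd_of_dvd hd₂')
    have hK : 0 < ((((a / (a / d₁).gcd (b / d₂)) * (b / (a / d₁).gcd (b / d₂)) : ℕ) : ℝ) / Q ^ 2) := by
      have hK0 : (a / (a / d₁).gcd (b / d₂)) * (b / (a / d₁).gcd (b / d₂)) ≠ 0 :=
        mul_ne_zero (fun h ↦ ha (Nat.eq_zero_of_dvd_of_div_eq_zero hca h))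
          (fun h ↦ hb (Nat.eq_zero_of_dvd_of_div_eq_zero hcb h))
      have : (0 : ℝ) < (((a / (a / d₁).gcd (b / d₂)) * (b / (a / d₁).gcd (b / d₂)) : ℕ) : ℝ) := by
        exact_mod_cast Nat.pos_of_ne_zero hK0
      positivity
    have hW := bose_zero_zero_eq_scriptW hK 0 0
    simp only [pow_zero, one_mul, mul_one] at hW
    rw [hG, hW]
  rw [Finset.sum_congr rfl fun d₁ hd₁ ↦ Finset.sum_congr rfl fun d₂ hd₂ ↦ hterm d₁ hd₁ d₂ hd₂,
    ← Finset.sum_product' (f := fun d₁ d₂ ↦ G ((a / d₁).gcd (b / d₂))), sum_divisorPairs_gcd ha hb G]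
  -- now `Σ_{c ∣ (a,b)} τ((a/c)(b/c)) · (c (ab)^{-1/2} 𝒲(..)) = (ab)^{1/2} K_true`
  unfold Corner.trueDiagKernel Corner.hKernel
  rw [← mul_div_assoc, eq_div_iff hab.ne', Finset.sum_mul, Finset.mul_sum]
  refine Finset.sum_congr rfl fun c _ ↦ ?_
  have hhalf : ((a : ℝ) * b) ^ (-(1 / 2 : ℝ)) * ((a : ℝ) * b) = ((a : ℝ) * b) ^ (1 / 2 : ℝ) := by
    rw [show ((a : ℝ) * b) ^ (-(1 / 2 : ℝ)) * ((a : ℝ) * b) = ((a : ℝ) * b) ^ (-(1 / 2 : ℝ)) * ((a : ℝ) * b) ^ (1 : ℝ) by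
      rw [Real.rpow_one], ← Real.rpow_add hab]
    norm_num
  rw [hG]
  linear_combination ((c : ℝ) * ((((a / c) * (b / c)).divisors.card : ℕ) : ℝ) *
    Corner.scriptW ((((a / c) * (b / c) : ℕ) : ℝ) / Q ^ 2)) * hhalf

/-- **At `Q = 1` the explicit line series is K_B's kernel form** (every level `q`, every `P`, `Δ'`; `M = q̂^{Δ'}`):
`Σ_{i,j ≤ deg 1} … = 2q̂ · Σ_{m₁,m₂ ≤ M} x_{m₁}x_{m₂} (m₁m₂)^{1/2} Corner.trueDiagKernel q̂ m₁ m₂`.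
[cite: KowalskiMichelVanderKam2000, (21)–(23) p. 12–13 — derivation] -/
theorem lineSeries_one_eq (q : ℕ) [NeZero q] (P : ℝ[X]) (Δ' : ℝ) :
    ∑ i ∈ Finset.range ((1 : ℝ[X]).natDegree + 1), ∑ j ∈ Finset.range ((1 : ℝ[X]).natDegree + 1),
        ((1 : ℝ[X]).coeff i : ℂ) * ((1 : ℝ[X]).coeff j : ℂ) * (((Real.log (KMV2000.qhat q))⁻¹ : ℝ) : ℂ) ^ (i + j) *
          (1 + (-1 : ℂ) ^ (i + j)) * (KMV2000.qhat q : ℂ) *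
        ∑ m₁ ∈ Finset.Icc 1 ⌊KMV2000.qhat q ^ Δ'⌋₊, ∑ m₂ ∈ Finset.Icc 1 ⌊KMV2000.qhat q ^ Δ'⌋₊,
          (KMV2000.mollifierCoeff P (KMV2000.qhat q ^ Δ') m₁ : ℂ) *
            (KMV2000.mollifierCoeff P (KMV2000.qhat q ^ Δ') m₂ : ℂ) *
          ∑ d₁ ∈ m₁.divisors, ∑ d₂ ∈ m₂.divisors,
            (((((m₁ / d₁).gcd (m₂ / d₂) : ℝ) * ((m₁ : ℝ) * m₂) ^ (-(1 / 2 : ℝ)) *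
              (∫ u₁ in Set.Ioi (0 : ℝ),
                (Real.log (KMV2000.qhat q / ((d₁ * (m₂ / d₂ / (m₁ / d₁).gcd (m₂ / d₂)) : ℕ) : ℝ)) + Real.log u₁) ^ i *
                ∫ u₂ in Set.Ioi (((((m₁ / (m₁ / d₁).gcd (m₂ / d₂)) * (m₂ / (m₁ / d₁).gcd (m₂ / d₂)) : ℕ) : ℝ) /
                    KMV2000.qhat q ^ 2) / u₁),
                  Real.exp (-(u₁ + u₂)) / (1 - Real.exp (-(u₁ + u₂))) ^ 2 *
                  (Real.log (KMV2000.qhat q / ((d₂ * (m₁ / d₁ / (m₁ / d₁).gcd (m₂ / d₂)) : ℕ) : ℝ)) + Real.log u₂) ^ j)) : ℝ) : ℂ) =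
      (((2 * KMV2000.qhat q * ∑ m₁ ∈ Finset.Icc 1 ⌊KMV2000.qhat q ^ Δ'⌋₊, ∑ m₂ ∈ Finset.Icc 1 ⌊KMV2000.qhat q ^ Δ'⌋₊,
        KMV2000.mollifierCoeff P (KMV2000.qhat q ^ Δ') m₁ * KMV2000.mollifierCoeff P (KMV2000.qhat q ^ Δ') m₂ *
        (((m₁ : ℝ) * m₂) ^ (1 / 2 : ℝ) * Corner.trueDiagKernel (KMV2000.qhat q) m₁ m₂) : ℝ)) : ℂ) := by
  have hQ : 0 < KMV2000.qhat q := KMV2000.qhat_pos_of_neZero q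
  -- the real identity, pair by pair
  have hR : 2 * KMV2000.qhat q * ∑ m₁ ∈ Finset.Icc 1 ⌊KMV2000.qhat q ^ Δ'⌋₊, ∑ m₂ ∈ Finset.Icc 1 ⌊KMV2000.qhat q ^ Δ'⌋₊,
        KMV2000.mollifierCoeff P (KMV2000.qhat q ^ Δ') m₁ * KMV2000.mollifierCoeff P (KMV2000.qhat q ^ Δ') m₂ *
        (((m₁ : ℝ) * m₂) ^ (1 / 2 : ℝ) * Corner.trueDiagKernel (KMV2000.qhat q) m₁ m₂) =
      2 * KMV2000.qhat q * ∑ m₁ ∈ Finset.Icc 1 ⌊KMV2000.qhat q ^ Δ'⌋₊, ∑ m₂ ∈ Finset.Icc 1 ⌊KMV2000.qhat q ^ Δ'⌋₊,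
        KMV2000.mollifierCoeff P (KMV2000.qhat q ^ Δ') m₁ * KMV2000.mollifierCoeff P (KMV2000.qhat q ^ Δ') m₂ *
        ∑ d₁ ∈ m₁.divisors, ∑ d₂ ∈ m₂.divisors,
          (((m₁ / d₁).gcd (m₂ / d₂) : ℝ) * ((m₁ : ℝ) * m₂) ^ (-(1 / 2 : ℝ)) *
            ∫ u₁ in Set.Ioi (0 : ℝ),
              ∫ u₂ in Set.Ioi (((((m₁ / (m₁ / d₁).gcd (m₂ / d₂)) * (m₂ / (m₁ / d₁).gcd (m₂ / d₂)) : ℕ) : ℝ) /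
                  KMV2000.qhat q ^ 2) / u₁), Real.exp (-(u₁ + u₂)) / (1 - Real.exp (-(u₁ + u₂))) ^ 2) := by
    congr 1
    refine Finset.sum_congr rfl fun m₁ hm₁ ↦ Finset.sum_congr rfl fun m₂ hm₂ ↦ ?_
    have hm₁0 : m₁ ≠ 0 := by have := (Finset.mem_Icc.mp hm₁).1; omega
    have hm₂0 : m₂ ≠ 0 := by have := (Finset.mem_Icc.mp hm₂).1; omega
    rw [lineSeries_pair_zero_zero hQ hm₁0 hm₂0]
  rw [hR, Polynomial.natDegree_one]
  simp only [zero_add, Finset.sum_range_one, Polynomial.coeff_one_zero, Complex.ofReal_one, one_mul, pow_zero, add_zero,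
    mul_one]
  push_cast
  ring

end Summit.Parity.GeneralizedHardyLittlewood.Theorems.MomentsBeyondDiagonal.DiagLines

end
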